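import Literature.MathematicalPhysics.QuantumLattice.HubbardSliceWeightMixedXi
import Literature.MathematicalPhysics.QuantumLattice.HubbardSliceSymbolSmoothOmegaThird
import Literature.MathematicalPhysics.QuantumLattice.HubbardSliceSymbolXiIncrements
import HarnessLib

/-!
# The band increments of the FREQUENCY derivatives of the slice symbol:
# `‖∂_ω^aΨ(ξ + y, ω) − ∂_ω^aΨ(ξ, ω)‖ ≤ M_a·|y|`, `M_a ≲ c/Λ^{a+2}` (`a = 1, 2, 3`), and the third TIME differences of a band increment

Topic `MathematicalPhysics/QuantumLattice`; continues `HubbardSliceWeightMixedXi` (the mixed weight derivatives `∂_ξ∂_ω^aW`) and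
`HubbardSliceSymbolSmoothOmegaThird` (`∂_ω³Ψ`).  In the flow-piece telescoping of the WEIGHTED slice propagator (Benfatto–Giuliani–Mastropietro 2006,
§3 (3.2)–(3.8)) the `m`-th increment `Ψ(e + w, ω) − Ψ(e, ω)` must carry the factor `|w|` in EVERY direction of the dual torus; in the time direction
this is the mean value inequality in the band variable `ξ` applied to `∂_ω^aΨ`, whose `ξ`-derivatives are computed here from the product structure
`Ψ^{(a)} = Σ C(a,i) W^{(i)} R^{(a−i)}`, `∂_ξ W^{(i)}` = the mixed weight derivatives, `∂_ξ R^{(k)} = i·R^{(k+1)}`: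

* §1 `resolventFnD4`, `hasDerivAt_resolventFn_xi`, `…D1_xi`, `…D2_xi`, `…D3_xi` — `∂_ξ R^{(k)} = i·R^{(k+1)}` off the pole, `‖R⁽⁴⁾‖ = 24c/|·|⁵`;
* §2 `sliceSymbolFnD1Xi1`, `sliceSymbolFnD2Xi1`, `sliceSymbolFnD3Xi1` (the mixed derivatives `∂_ξ∂_ω^aΨ`), `hasDerivAt_sliceSymbolFnD1_xi`, `…D2_xi`,
  `…D3_xi`, and the bounds **`norm_sliceSymbolFnD1Xi1_le`** `≤ (32B₂+128B₁+128)c/Λ³`, **`…D2Xi1_le`** `≤ (64B₃+416B₂+1600B₁+1536)c/Λ⁴`,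
  **`…D3Xi1_le`** `≤ (128B₄+1216B₃+6912B₂+26112B₁+24576)c/Λ⁵`;
* §3 **`norm_sliceSymbolFnD1_sub_xi_le`**, **`…D2…`**, **`…D3…`** — the increments `‖Ψ^{(a)}(ξ+y, ·) − Ψ^{(a)}(ξ, ·)‖ ≤ M_a|y|`;
* §4 **`norm_fwdDiff_iter_three_sliceSymbolFn_incr_le`** — `‖Δ_δ³[Ψ(ξ+y, ·) − Ψ(ξ, ·)](ω)‖ ≤ δ³·M₃·|y|` (`δ ≥ 0`).

(`c ≥ 0`, `0 < Λ ≤ Λ′`, `|θ| ≤ Λ/4`; `B₁ … B₄` global bounds of `χ₂′ … χ₂⁗`.)  Everything is proved; no named facts.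

## Sources

G. Benfatto, A. Giuliani, V. Mastropietro, Ann. Henri Poincaré 7 (2006) 809–898, (2.36aa), §2.1 (2.3), §3 (3.2)–(3.8) (`BenfattoGiulianiMastropietro2006`);
M. Salmhofer, *Renormalization* (1999), §4.2.5 (4.70)–(4.71) (`Salmhofer1999`).
-/

noncomputable section

namespace Literature.MathematicalPhysics.QuantumLattice

open Literature.Probability.LatticeModels Set Complex

/-! ### §1 The resolvent factor: `ξ`-derivatives of the frequency derivatives -/

/-- `∂_ω⁴ R = 24c/(−i(ω+θ)+ξ)⁵`. [cite: BenfattoGiulianiMastropietro2006, §2.1 (2.3)] -/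
def resolventFnD4 (c θ ξ ω : ℝ) : ℂ := 24 * (c : ℂ) / (-I * ((ω + θ : ℝ) : ℂ) + (ξ : ℂ)) ^ 5

/-- `‖∂_ω⁴ R‖ = 24c/|a|⁵`. [cite: BenfattoGiulianiMastropietro2006, §2.1 (2.3)] -/
theorem norm_resolventFnD4 {c : ℝ} (hc : 0 ≤ c) (θ ξ ω : ℝ) :
    ‖resolventFnD4 c θ ξ ω‖ = 24 * c / ‖-I * ((ω + θ : ℝ) : ℂ) + (ξ : ℂ)‖ ^ 5 := by
  rw [resolventFnD4, norm_div, norm_mul, Complex.norm_real, Real.norm_eq_abs, abs_of_nonneg hc, norm_pow]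
  norm_num

section ResolventXi

variable {c θ ξ ω : ℝ}

/-- `∂_ξ R = i·R′` off the pole. [cite: BenfattoGiulianiMastropietro2006, §2.1 (2.3)] -/
theorem hasDerivAt_resolventFn_xi (h : (-I * ((ω + θ : ℝ) : ℂ) + (ξ : ℂ)) ≠ 0) :
    HasDerivAt (fun t : ℝ => resolventFn c θ t ω) (I * resolventFnD1 c θ ξ ω) ξ := by
  unfold resolventFn resolventFnD1
  have hinv := ((hasDerivAt_inv h).comp ξ (hasDerivAt_shiftDen_xi θ ω ξ)).const_mul (c : ℂ)
  refine (hinv.congr_of_eventuallyEq (Filter.Eventually.of_forall fun t => ?_)).congr_deriv ?_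
  · simp only [Function.comp, div_eq_mul_inv]
  · have h2 : (-I * ((ω + θ : ℝ) : ℂ) + (ξ : ℂ)) ^ 2 ≠ 0 := pow_ne_zero 2 h
    field_simp
    ring_nf
    rw [Complex.I_sq]
    ring

/-- `∂_ξ R′ = i·R″` off the pole. [cite: BenfattoGiulianiMastropietro2006, §2.1 (2.3)] -/
theorem hasDerivAt_resolventFnD1_xi (h : (-I * ((ω + θ : ℝ) : ℂ) + (ξ : ℂ)) ≠ 0) :
    HasDerivAt (fun t : ℝ => resolventFnD1 c θ t ω) (I * resolventFnD2 c θ ξ ω) ξ := by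
  unfold resolventFnD1 resolventFnD2
  have h2 : (-I * ((ω + θ : ℝ) : ℂ) + (ξ : ℂ)) ^ 2 ≠ 0 := pow_ne_zero 2 h
  have hsq : HasDerivAt (fun t : ℝ => (-I * ((ω + θ : ℝ) : ℂ) + (t : ℂ)) ^ 2)
      ((2 : ℕ) * (-I * ((ω + θ : ℝ) : ℂ) + (ξ : ℂ)) ^ (2 - 1) * 1) ξ :=
    (hasDerivAt_shiftDen_xi θ ω ξ).pow 2
  have hinv := ((hasDerivAt_inv h2).comp ξ hsq).const_mul ((c : ℂ) * I)
  refine (hinv.congr_of_eventuallyEq (Filter.Eventually.of_forall fun t => ?_)).congr_deriv ?_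
  · simp only [Function.comp, div_eq_mul_inv]
  · set a : ℂ := -I * ((ω + θ : ℝ) : ℂ) + (ξ : ℂ) with ha
    have h3 : a ^ 3 ≠ 0 := pow_ne_zero 3 h
    have h4 : (a ^ 2) ^ 2 ≠ 0 := pow_ne_zero 2 h2
    rw [show (2 : ℕ) - 1 = 1 from rfl, pow_one]
    field_simp
    ring_nf

/-- `∂_ξ R″ = i·R‴` off the pole. [cite: BenfattoGiulianiMastropietro2006, §2.1 (2.3)] -/
theorem hasDerivAt_resolventFnD2_xi (h : (-I * ((ω + θ : ℝ) : ℂ) + (ξ : ℂ)) ≠ 0) :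
    HasDerivAt (fun t : ℝ => resolventFnD2 c θ t ω) (I * resolventFnD3 c θ ξ ω) ξ := by
  unfold resolventFnD2 resolventFnD3
  have h3 : (-I * ((ω + θ : ℝ) : ℂ) + (ξ : ℂ)) ^ 3 ≠ 0 := pow_ne_zero 3 h
  have hcb : HasDerivAt (fun t : ℝ => (-I * ((ω + θ : ℝ) : ℂ) + (t : ℂ)) ^ 3)
      ((3 : ℕ) * (-I * ((ω + θ : ℝ) : ℂ) + (ξ : ℂ)) ^ (3 - 1) * 1) ξ :=
    (hasDerivAt_shiftDen_xi θ ω ξ).pow 3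
  have hinv := ((hasDerivAt_inv h3).comp ξ hcb).const_mul (-2 * (c : ℂ))
  refine (hinv.congr_of_eventuallyEq (Filter.Eventually.of_forall fun t => ?_)).congr_deriv ?_
  · simp only [Function.comp, div_eq_mul_inv]
  · set a : ℂ := -I * ((ω + θ : ℝ) : ℂ) + (ξ : ℂ) with ha
    have h4 : a ^ 4 ≠ 0 := pow_ne_zero 4 h
    have h6 : (a ^ 3) ^ 2 ≠ 0 := pow_ne_zero 2 h3
    rw [show (3 : ℕ) - 1 = 2 from rfl]
    field_simp
    ring_nf
    rw [Complex.I_sq]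
    ring

/-- `∂_ξ R‴ = i·R⁽⁴⁾` off the pole. [cite: BenfattoGiulianiMastropietro2006, §2.1 (2.3)] -/
theorem hasDerivAt_resolventFnD3_xi (h : (-I * ((ω + θ : ℝ) : ℂ) + (ξ : ℂ)) ≠ 0) :
    HasDerivAt (fun t : ℝ => resolventFnD3 c θ t ω) (I * resolventFnD4 c θ ξ ω) ξ := by
  unfold resolventFnD3 resolventFnD4
  have h4 : (-I * ((ω + θ : ℝ) : ℂ) + (ξ : ℂ)) ^ 4 ≠ 0 := pow_ne_zero 4 h
  have hqt : HasDerivAt (fun t : ℝ => (-I * ((ω + θ : ℝ) : ℂ) + (t : ℂ)) ^ 4)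
      ((4 : ℕ) * (-I * ((ω + θ : ℝ) : ℂ) + (ξ : ℂ)) ^ (4 - 1) * 1) ξ :=
    (hasDerivAt_shiftDen_xi θ ω ξ).pow 4
  have hinv := ((hasDerivAt_inv h4).comp ξ hqt).const_mul (-6 * (c : ℂ) * I)
  refine (hinv.congr_of_eventuallyEq (Filter.Eventually.of_forall fun t => ?_)).congr_deriv ?_
  · simp only [Function.comp, div_eq_mul_inv]
  · set a : ℂ := -I * ((ω + θ : ℝ) : ℂ) + (ξ : ℂ) with ha
    have h5 : a ^ 5 ≠ 0 := pow_ne_zero 5 h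
    have h8 : (a ^ 4) ^ 2 ≠ 0 := pow_ne_zero 2 h4
    rw [show (4 : ℕ) - 1 = 3 from rfl]
    field_simp
    ring_nf

end ResolventXi

/-! ### §2 The mixed derivatives `∂_ξ ∂_ω^a Ψ` (`a = 1, 2, 3`): formulas, differentiability, bounds -/

/-- `∂_ξ Ψ′ = V₁R + W′·iR′ + W_ξR′ + W·iR″` (`V₁ = ∂_ξW′`, `W_ξ = ∂_ξW`). [cite: Salmhofer1999, §4.2.5 (4.70)] -/
def sliceSymbolFnD1Xi1 (c θ Λ Λ' ξ ω : ℝ) : ℂ :=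
  (sliceWeightFnD1Xi Λ Λ' ξ ω : ℂ) * resolventFn c θ ξ ω + (sliceWeightFnD1 Λ Λ' ξ ω : ℂ) * (I * resolventFnD1 c θ ξ ω) +
    ((sliceWeightFnD1 Λ Λ' ω ξ : ℂ) * resolventFnD1 c θ ξ ω + (sliceWeightFn Λ Λ' ξ ω : ℂ) * (I * resolventFnD2 c θ ξ ω))

/-- `∂_ξ Ψ″`. [cite: Salmhofer1999, §4.2.5 (4.70)] -/
def sliceSymbolFnD2Xi1 (c θ Λ Λ' ξ ω : ℝ) : ℂ :=
  (sliceWeightFnD2Xi Λ Λ' ξ ω : ℂ) * resolventFn c θ ξ ω + (sliceWeightFnD2 Λ Λ' ξ ω : ℂ) * (I * resolventFnD1 c θ ξ ω) +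
    2 * ((sliceWeightFnD1Xi Λ Λ' ξ ω : ℂ) * resolventFnD1 c θ ξ ω + (sliceWeightFnD1 Λ Λ' ξ ω : ℂ) * (I * resolventFnD2 c θ ξ ω)) +
    ((sliceWeightFnD1 Λ Λ' ω ξ : ℂ) * resolventFnD2 c θ ξ ω + (sliceWeightFn Λ Λ' ξ ω : ℂ) * (I * resolventFnD3 c θ ξ ω))

/-- `∂_ξ Ψ‴`. [cite: Salmhofer1999, §4.2.5 (4.70)] -/
def sliceSymbolFnD3Xi1 (c θ Λ Λ' ξ ω : ℝ) : ℂ :=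
  (sliceWeightFnD3Xi Λ Λ' ξ ω : ℂ) * resolventFn c θ ξ ω + (sliceWeightFnD3 Λ Λ' ξ ω : ℂ) * (I * resolventFnD1 c θ ξ ω) +
    3 * ((sliceWeightFnD2Xi Λ Λ' ξ ω : ℂ) * resolventFnD1 c θ ξ ω + (sliceWeightFnD2 Λ Λ' ξ ω : ℂ) * (I * resolventFnD2 c θ ξ ω)) +
    3 * ((sliceWeightFnD1Xi Λ Λ' ξ ω : ℂ) * resolventFnD2 c θ ξ ω + (sliceWeightFnD1 Λ Λ' ξ ω : ℂ) * (I * resolventFnD3 c θ ξ ω)) +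
    ((sliceWeightFnD1 Λ Λ' ω ξ : ℂ) * resolventFnD3 c θ ξ ω + (sliceWeightFn Λ Λ' ξ ω : ℂ) * (I * resolventFnD4 c θ ξ ω))

section Symbol

variable {c θ Λ Λ' ω : ℝ}

/-- The case split in the band variable: either `ξ² + ω² > Λ²/5` (denominator nonzero) or all weight factors vanish near `ξ`.
[cite: BenfattoGiulianiMastropietro2006, (2.36aa)] -/
theorem weights_eventually_zero_xi (hΛ : 0 < Λ) (hΛΛ' : Λ ≤ Λ') {ξ : ℝ} (h : ¬ Λ ^ 2 / 5 < ξ ^ 2 + ω ^ 2) :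
    ∀ᶠ t in nhds ξ, sliceWeightFn Λ Λ' t ω = 0 ∧ sliceWeightFnD1 Λ Λ' t ω = 0 ∧ sliceWeightFnD2 Λ Λ' t ω = 0 ∧
      sliceWeightFnD3 Λ Λ' t ω = 0 ∧ sliceWeightFnD1 Λ Λ' ω t = 0 := by
  have hlt : ξ ^ 2 + ω ^ 2 < Λ ^ 2 / 4 := by linarith [not_lt.1 h, pow_pos hΛ 2]
  have hopen : ∀ᶠ t in nhds ξ, t ^ 2 + ω ^ 2 < Λ ^ 2 / 4 :=
    (continuous_pow 2 |>.add continuous_const).continuousAt.eventually_lt continuousAt_const hlt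
  filter_upwards [hopen] with t ht
  have ht' : ω ^ 2 + t ^ 2 < Λ ^ 2 / 4 := by linarith
  obtain ⟨h0, h1, h2⟩ := sliceWeightFn_eq_zero_of_not_mem hΛ hΛΛ' (ξ := t) (ω := ω) (Or.inl ht')
  have h3 := sliceWeightFnD3_eq_zero_of_not_mem hΛ hΛΛ' (ξ := t) (ω := ω) (Or.inl ht')
  obtain ⟨-, h1', -⟩ := sliceWeightFn_eq_zero_of_not_mem hΛ hΛΛ' (ξ := ω) (ω := t) (Or.inl ht)
  exact ⟨h0, h1, h2, h3, h1'⟩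

/-- In the inner disc the mixed weight factors vanish too. [cite: Salmhofer1999, §4.2.5 (4.71)] -/
theorem weights_zero_xi (hΛ : 0 < Λ) (hΛΛ' : Λ ≤ Λ') {ξ : ℝ} (h : ¬ Λ ^ 2 / 5 < ξ ^ 2 + ω ^ 2) :
    sliceWeightFn Λ Λ' ξ ω = 0 ∧ sliceWeightFnD1 Λ Λ' ξ ω = 0 ∧ sliceWeightFnD2 Λ Λ' ξ ω = 0 ∧ sliceWeightFnD3 Λ Λ' ξ ω = 0 ∧
      sliceWeightFnD1 Λ Λ' ω ξ = 0 ∧ sliceWeightFnD1Xi Λ Λ' ξ ω = 0 ∧ sliceWeightFnD2Xi Λ Λ' ξ ω = 0 ∧ sliceWeightFnD3Xi Λ Λ' ξ ω = 0 := by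
  have hlt : ω ^ 2 + ξ ^ 2 < Λ ^ 2 / 4 := by linarith [not_lt.1 h, pow_pos hΛ 2]
  obtain ⟨h0, h1, h2⟩ := sliceWeightFn_eq_zero_of_not_mem hΛ hΛΛ' (ξ := ξ) (ω := ω) (Or.inl hlt)
  have h3 := sliceWeightFnD3_eq_zero_of_not_mem hΛ hΛΛ' (ξ := ξ) (ω := ω) (Or.inl hlt)
  obtain ⟨-, h1', -⟩ := sliceWeightFn_eq_zero_of_not_mem hΛ hΛΛ' (ξ := ω) (ω := ξ) (Or.inl (by linarith))
  obtain ⟨v1, v2, v3⟩ := sliceWeightFnDXi_eq_zero_of_not_mem hΛ hΛΛ' (ξ := ξ) (ω := ω) (Or.inl hlt)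
  exact ⟨h0, h1, h2, h3, h1', v1, v2, v3⟩

/-- **`∂_ξ Ψ′ = sliceSymbolFnD1Xi1`**: `t ↦ Ψ′(t, ω)` is differentiable in the band variable everywhere.
[cite: BenfattoGiulianiMastropietro2006, (2.36aa)] -/
theorem hasDerivAt_sliceSymbolFnD1_xi (hΛ : 0 < Λ) (hΛΛ' : Λ ≤ Λ') (hθ : |θ| ≤ Λ / 4) (ξ : ℝ) :
    HasDerivAt (fun t : ℝ => sliceSymbolFnD1 c θ Λ Λ' t ω) (sliceSymbolFnD1Xi1 c θ Λ Λ' ξ ω) ξ := by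
  by_cases h : Λ ^ 2 / 5 < ξ ^ 2 + ω ^ 2
  · have hne : (-I * ((ω + θ : ℝ) : ℂ) + (ξ : ℂ)) ≠ 0 := shiftDen_ne_zero_of_gt hθ (by linarith)
    unfold sliceSymbolFnD1 sliceSymbolFnD1Xi1
    have hA := (hasDerivAt_sliceWeightFnD1_xi Λ Λ' ξ ω).ofReal_comp.mul (hasDerivAt_resolventFn_xi (c := c) hne)
    have hB := (hasDerivAt_sliceWeightFn_xi Λ Λ' ξ ω).ofReal_comp.mul (hasDerivAt_resolventFnD1_xi (c := c) hne)
    exact hA.add hB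
  · have hev := weights_eventually_zero_xi hΛ hΛΛ' h
    have hev' : (fun t : ℝ => sliceSymbolFnD1 c θ Λ Λ' t ω) =ᶠ[nhds ξ] fun _ => (0 : ℂ) := by
      filter_upwards [hev] with t ht
      rw [sliceSymbolFnD1, ht.1, ht.2.1, Complex.ofReal_zero, zero_mul, zero_mul, add_zero]
    obtain ⟨h0, h1, -, -, h1', v1, -, -⟩ := weights_zero_xi hΛ hΛΛ' h
    have hD : sliceSymbolFnD1Xi1 c θ Λ Λ' ξ ω = 0 := by
      rw [sliceSymbolFnD1Xi1, h0, h1, h1', v1, Complex.ofReal_zero]; ring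
    rw [hD]
    exact (hasDerivAt_const ξ (0 : ℂ)).congr_of_eventuallyEq hev'

/-- **`∂_ξ Ψ″ = sliceSymbolFnD2Xi1`.** [cite: BenfattoGiulianiMastropietro2006, (2.36aa)] -/
theorem hasDerivAt_sliceSymbolFnD2_xi (hΛ : 0 < Λ) (hΛΛ' : Λ ≤ Λ') (hθ : |θ| ≤ Λ / 4) (ξ : ℝ) :
    HasDerivAt (fun t : ℝ => sliceSymbolFnD2 c θ Λ Λ' t ω) (sliceSymbolFnD2Xi1 c θ Λ Λ' ξ ω) ξ := by
  by_cases h : Λ ^ 2 / 5 < ξ ^ 2 + ω ^ 2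
  · have hne : (-I * ((ω + θ : ℝ) : ℂ) + (ξ : ℂ)) ≠ 0 := shiftDen_ne_zero_of_gt hθ (by linarith)
    unfold sliceSymbolFnD2 sliceSymbolFnD2Xi1
    have hA := (hasDerivAt_sliceWeightFnD2_xi Λ Λ' ξ ω).ofReal_comp.mul (hasDerivAt_resolventFn_xi (c := c) hne)
    have hB := ((hasDerivAt_sliceWeightFnD1_xi Λ Λ' ξ ω).ofReal_comp.mul (hasDerivAt_resolventFnD1_xi (c := c) hne)).const_mul (2 : ℂ)
    have hC := (hasDerivAt_sliceWeightFn_xi Λ Λ' ξ ω).ofReal_comp.mul (hasDerivAt_resolventFnD2_xi (c := c) hne)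
    exact (hA.add hB).add hC
  · have hev := weights_eventually_zero_xi hΛ hΛΛ' h
    have hev' : (fun t : ℝ => sliceSymbolFnD2 c θ Λ Λ' t ω) =ᶠ[nhds ξ] fun _ => (0 : ℂ) := by
      filter_upwards [hev] with t ht
      rw [sliceSymbolFnD2, ht.1, ht.2.1, ht.2.2.1, Complex.ofReal_zero]; ring
    obtain ⟨h0, h1, h2, -, h1', v1, v2, -⟩ := weights_zero_xi hΛ hΛΛ' h
    have hD : sliceSymbolFnD2Xi1 c θ Λ Λ' ξ ω = 0 := by
      rw [sliceSymbolFnD2Xi1, h0, h1, h2, h1', v1, v2, Complex.ofReal_zero]; ring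
    rw [hD]
    exact (hasDerivAt_const ξ (0 : ℂ)).congr_of_eventuallyEq hev'

/-- **`∂_ξ Ψ‴ = sliceSymbolFnD3Xi1`.** [cite: BenfattoGiulianiMastropietro2006, (2.36aa)] -/
theorem hasDerivAt_sliceSymbolFnD3_xi (hΛ : 0 < Λ) (hΛΛ' : Λ ≤ Λ') (hθ : |θ| ≤ Λ / 4) (ξ : ℝ) :
    HasDerivAt (fun t : ℝ => sliceSymbolFnD3 c θ Λ Λ' t ω) (sliceSymbolFnD3Xi1 c θ Λ Λ' ξ ω) ξ := by
  by_cases h : Λ ^ 2 / 5 < ξ ^ 2 + ω ^ 2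
  · have hne : (-I * ((ω + θ : ℝ) : ℂ) + (ξ : ℂ)) ≠ 0 := shiftDen_ne_zero_of_gt hθ (by linarith)
    unfold sliceSymbolFnD3 sliceSymbolFnD3Xi1
    have hA := (hasDerivAt_sliceWeightFnD3_xi Λ Λ' ξ ω).ofReal_comp.mul (hasDerivAt_resolventFn_xi (c := c) hne)
    have hB := ((hasDerivAt_sliceWeightFnD2_xi Λ Λ' ξ ω).ofReal_comp.mul (hasDerivAt_resolventFnD1_xi (c := c) hne)).const_mul (3 : ℂ)
    have hC := ((hasDerivAt_sliceWeightFnD1_xi Λ Λ' ξ ω).ofReal_comp.mul (hasDerivAt_resolventFnD2_xi (c := c) hne)).const_mul (3 : ℂ)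
    have hD := (hasDerivAt_sliceWeightFn_xi Λ Λ' ξ ω).ofReal_comp.mul (hasDerivAt_resolventFnD3_xi (c := c) hne)
    exact ((hA.add hB).add hC).add hD
  · have hev := weights_eventually_zero_xi hΛ hΛΛ' h
    have hev' : (fun t : ℝ => sliceSymbolFnD3 c θ Λ Λ' t ω) =ᶠ[nhds ξ] fun _ => (0 : ℂ) := by
      filter_upwards [hev] with t ht
      rw [sliceSymbolFnD3, ht.1, ht.2.1, ht.2.2.1, ht.2.2.2.1, Complex.ofReal_zero]; ring
    obtain ⟨h0, h1, h2, h3, h1', v1, v2, v3⟩ := weights_zero_xi hΛ hΛΛ' h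
    have hD : sliceSymbolFnD3Xi1 c θ Λ Λ' ξ ω = 0 := by
      rw [sliceSymbolFnD3Xi1, h0, h1, h2, h3, h1', v1, v2, v3, Complex.ofReal_zero]; ring
    rw [hD]
    exact (hasDerivAt_const ξ (0 : ℂ)).congr_of_eventuallyEq hev'

section Bounds

variable {B₁ B₂ B₃ B₄ : ℝ}

/-- The resolvent norms on the closed shell, and the trivial bound off it: a uniform package `‖R^{(k)}‖ ≤ k!·4^{k+1}·c/Λ^{k+1}` whenever the
weight factors are nonzero is all the bounds below use; we state the shell estimates. [cite: BenfattoGiulianiMastropietro2006, §2.1 (2.3)] -/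
theorem resolvent_norms_on_shell (hθ : |θ| ≤ Λ / 4) (hc : 0 ≤ c) (hΛ : 0 < Λ) {ξ : ℝ} (hmem : Λ ^ 2 / 4 ≤ ω ^ 2 + ξ ^ 2) :
    ‖resolventFn c θ ξ ω‖ ≤ 4 * c / Λ ∧ ‖resolventFnD1 c θ ξ ω‖ ≤ 16 * c / Λ ^ 2 ∧ ‖resolventFnD2 c θ ξ ω‖ ≤ 128 * c / Λ ^ 3 ∧
      ‖resolventFnD3 c θ ξ ω‖ ≤ 1536 * c / Λ ^ 4 ∧ ‖resolventFnD4 c θ ξ ω‖ ≤ 24576 * c / Λ ^ 5 := by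
  have hden := norm_shiftDen_ge hθ hmem
  set a := ‖-I * ((ω + θ : ℝ) : ℂ) + (ξ : ℂ)‖ with ha
  have ha0 : 0 < a := lt_of_lt_of_le (by positivity) hden
  refine ⟨?_, ?_, ?_, ?_, ?_⟩
  · rw [norm_resolventFn hc, div_le_div_iff₀ ha0 hΛ]; nlinarith
  · rw [norm_resolventFnD1 hc, div_le_div_iff₀ (by positivity) (by positivity)]
    have : Λ ^ 2 ≤ 16 * a ^ 2 := by nlinarith
    nlinarith
  · rw [norm_resolventFnD2 hc, div_le_div_iff₀ (by positivity) (by positivity)]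
    have : Λ ^ 3 ≤ 64 * a ^ 3 := by nlinarith [pow_le_pow_left₀ (by positivity : 0 ≤ Λ / 4) hden 3]
    nlinarith
  · rw [norm_resolventFnD3 hc, div_le_div_iff₀ (by positivity) (by positivity)]
    have : Λ ^ 4 ≤ 256 * a ^ 4 := by nlinarith [pow_le_pow_left₀ (by positivity : 0 ≤ Λ / 4) hden 4]
    nlinarith
  · rw [norm_resolventFnD4 hc, div_le_div_iff₀ (by positivity) (by positivity)]
    have : Λ ^ 5 ≤ 1024 * a ^ 5 := by nlinarith [pow_le_pow_left₀ (by positivity : 0 ≤ Λ / 4) hden 5]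
    nlinarith

/-- The weight norms (complex casts) under `0 < Λ ≤ Λ′`. [cite: BenfattoGiulianiMastropietro2006, (2.36aa)] -/
theorem weight_norms (hB₁ : ∀ x, |deriv salmhoferCutoff x| ≤ B₁) (hB₂ : ∀ x, |deriv (deriv salmhoferCutoff) x| ≤ B₂)
    (hB₃ : ∀ x, |deriv (deriv (deriv salmhoferCutoff)) x| ≤ B₃) (hB₄ : ∀ x, |deriv (deriv (deriv (deriv salmhoferCutoff))) x| ≤ B₄)
    (hΛ : 0 < Λ) (hΛΛ' : Λ ≤ Λ') (ξ : ℝ) :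
    ‖(sliceWeightFn Λ Λ' ξ ω : ℂ)‖ ≤ 1 ∧ ‖(sliceWeightFnD1 Λ Λ' ξ ω : ℂ)‖ ≤ 4 * B₁ / Λ ∧
      ‖(sliceWeightFnD2 Λ Λ' ξ ω : ℂ)‖ ≤ (8 * B₂ + 4 * B₁) / Λ ^ 2 ∧ ‖(sliceWeightFnD3 Λ Λ' ξ ω : ℂ)‖ ≤ (16 * B₃ + 24 * B₂) / Λ ^ 3 ∧
      ‖(sliceWeightFnD1 Λ Λ' ω ξ : ℂ)‖ ≤ 4 * B₁ / Λ ∧ ‖(sliceWeightFnD1Xi Λ Λ' ξ ω : ℂ)‖ ≤ 8 * B₂ / Λ ^ 2 ∧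
      ‖(sliceWeightFnD2Xi Λ Λ' ξ ω : ℂ)‖ ≤ (16 * B₃ + 8 * B₂) / Λ ^ 3 ∧ ‖(sliceWeightFnD3Xi Λ Λ' ξ ω : ℂ)‖ ≤ (32 * B₄ + 48 * B₃) / Λ ^ 4 := by
  simp only [Complex.norm_real, Real.norm_eq_abs]
  exact ⟨abs_sliceWeightFn_le_one Λ Λ' ξ ω, abs_sliceWeightFnD1_le hB₁ hΛ hΛΛ' ξ ω, abs_sliceWeightFnD2_le hB₁ hB₂ hΛ hΛΛ' ξ ω,
    abs_sliceWeightFnD3_le hB₂ hB₃ hΛ hΛΛ' ξ ω, abs_sliceWeightFnD1_le hB₁ hΛ hΛΛ' ω ξ, abs_sliceWeightFnD1Xi_le hB₂ hΛ hΛΛ' ξ ω,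
    abs_sliceWeightFnD2Xi_le hB₂ hB₃ hΛ hΛΛ' ξ ω, abs_sliceWeightFnD3Xi_le hB₃ hB₄ hΛ hΛΛ' ξ ω⟩

/-- **`‖∂_ξΨ′‖ ≤ (32B₂ + 128B₁ + 128)·c/Λ³`** everywhere. [cite: BenfattoGiulianiMastropietro2006, (2.36aa)] -/
theorem norm_sliceSymbolFnD1Xi1_le (hΛ : 0 < Λ) (hΛΛ' : Λ ≤ Λ') (hθ : |θ| ≤ Λ / 4) (hc : 0 ≤ c)
    (hB₁ : ∀ x, |deriv salmhoferCutoff x| ≤ B₁) (hB₂ : ∀ x, |deriv (deriv salmhoferCutoff) x| ≤ B₂)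
    (hB₃ : ∀ x, |deriv (deriv (deriv salmhoferCutoff)) x| ≤ B₃) (hB₄ : ∀ x, |deriv (deriv (deriv (deriv salmhoferCutoff))) x| ≤ B₄)
    (ξ : ℝ) : ‖sliceSymbolFnD1Xi1 c θ Λ Λ' ξ ω‖ ≤ (32 * B₂ + 128 * B₁ + 128) * c / Λ ^ 3 := by
  have hB10 : 0 ≤ B₁ := (abs_nonneg _).trans (hB₁ 0)
  have hB20 : 0 ≤ B₂ := (abs_nonneg _).trans (hB₂ 0)
  by_cases hmem : ω ^ 2 + ξ ^ 2 < Λ ^ 2 / 4 ∨ Λ' ^ 2 < ω ^ 2 + ξ ^ 2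
  · obtain ⟨h0, h1, -⟩ := sliceWeightFn_eq_zero_of_not_mem hΛ hΛΛ' hmem
    have hmem' : ξ ^ 2 + ω ^ 2 < Λ ^ 2 / 4 ∨ Λ' ^ 2 < ξ ^ 2 + ω ^ 2 := by rcases hmem with h | h <;> [left; right] <;> linarith
    obtain ⟨-, h1', -⟩ := sliceWeightFn_eq_zero_of_not_mem hΛ hΛΛ' hmem'
    obtain ⟨v1, -, -⟩ := sliceWeightFnDXi_eq_zero_of_not_mem hΛ hΛΛ' hmem
    rw [sliceSymbolFnD1Xi1, h0, h1, h1', v1, Complex.ofReal_zero]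
    simp only [zero_mul, add_zero, norm_zero]
    positivity
  · rw [not_or, not_lt, not_lt] at hmem
    obtain ⟨hR, hR1, hR2, -, -⟩ := resolvent_norms_on_shell (c := c) hθ hc hΛ hmem.1
    obtain ⟨hW, hW1, -, -, hWx, hV1, -, -⟩ := weight_norms (ω := ω) hB₁ hB₂ hB₃ hB₄ hΛ hΛΛ' ξ
    rw [sliceSymbolFnD1Xi1]
    have nI : ∀ z : ℂ, ‖I * z‖ = ‖z‖ := fun z => by rw [norm_mul, Complex.norm_I, one_mul]
    calc _ ≤ ‖(sliceWeightFnD1Xi Λ Λ' ξ ω : ℂ) * resolventFn c θ ξ ω‖ + ‖(sliceWeightFnD1 Λ Λ' ξ ω : ℂ) * (I * resolventFnD1 c θ ξ ω)‖ +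
          (‖(sliceWeightFnD1 Λ Λ' ω ξ : ℂ) * resolventFnD1 c θ ξ ω‖ + ‖(sliceWeightFn Λ Λ' ξ ω : ℂ) * (I * resolventFnD2 c θ ξ ω)‖) :=
          (norm_add_le _ _).trans (add_le_add (norm_add_le _ _) (norm_add_le _ _))
      _ ≤ 8 * B₂ / Λ ^ 2 * (4 * c / Λ) + 4 * B₁ / Λ * (16 * c / Λ ^ 2) + (4 * B₁ / Λ * (16 * c / Λ ^ 2) + 1 * (128 * c / Λ ^ 3)) := by
          simp only [norm_mul, nI]
          exact add_le_add (add_le_add (mul_le_mul hV1 hR (norm_nonneg _) (by positivity))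
            (mul_le_mul hW1 hR1 (norm_nonneg _) (by positivity)))
            (add_le_add (mul_le_mul hWx hR1 (norm_nonneg _) (by positivity)) (mul_le_mul hW hR2 (norm_nonneg _) zero_le_one))
      _ = (32 * B₂ + 128 * B₁ + 128) * c / Λ ^ 3 := by field_simp; ring

/-- **`‖∂_ξΨ″‖ ≤ (64B₃ + 416B₂ + 1600B₁ + 1536)·c/Λ⁴`** everywhere. [cite: BenfattoGiulianiMastropietro2006, (2.36aa)] -/
theorem norm_sliceSymbolFnD2Xi1_le (hΛ : 0 < Λ) (hΛΛ' : Λ ≤ Λ') (hθ : |θ| ≤ Λ / 4) (hc : 0 ≤ c)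
    (hB₁ : ∀ x, |deriv salmhoferCutoff x| ≤ B₁) (hB₂ : ∀ x, |deriv (deriv salmhoferCutoff) x| ≤ B₂)
    (hB₃ : ∀ x, |deriv (deriv (deriv salmhoferCutoff)) x| ≤ B₃) (hB₄ : ∀ x, |deriv (deriv (deriv (deriv salmhoferCutoff))) x| ≤ B₄)
    (ξ : ℝ) : ‖sliceSymbolFnD2Xi1 c θ Λ Λ' ξ ω‖ ≤ (64 * B₃ + 416 * B₂ + 1600 * B₁ + 1536) * c / Λ ^ 4 := by
  have hB10 : 0 ≤ B₁ := (abs_nonneg _).trans (hB₁ 0)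
  have hB20 : 0 ≤ B₂ := (abs_nonneg _).trans (hB₂ 0)
  have hB30 : 0 ≤ B₃ := (abs_nonneg _).trans (hB₃ 0)
  by_cases hmem : ω ^ 2 + ξ ^ 2 < Λ ^ 2 / 4 ∨ Λ' ^ 2 < ω ^ 2 + ξ ^ 2
  · obtain ⟨h0, h1, h2⟩ := sliceWeightFn_eq_zero_of_not_mem hΛ hΛΛ' hmem
    have hmem' : ξ ^ 2 + ω ^ 2 < Λ ^ 2 / 4 ∨ Λ' ^ 2 < ξ ^ 2 + ω ^ 2 := by rcases hmem with h | h <;> [left; right] <;> linarith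
    obtain ⟨-, h1', -⟩ := sliceWeightFn_eq_zero_of_not_mem hΛ hΛΛ' hmem'
    obtain ⟨v1, v2, -⟩ := sliceWeightFnDXi_eq_zero_of_not_mem hΛ hΛΛ' hmem
    rw [sliceSymbolFnD2Xi1, h0, h1, h2, h1', v1, v2, Complex.ofReal_zero]
    simp only [zero_mul, mul_zero, add_zero, norm_zero]
    positivity
  · rw [not_or, not_lt, not_lt] at hmem
    obtain ⟨hR, hR1, hR2, hR3, -⟩ := resolvent_norms_on_shell (c := c) hθ hc hΛ hmem.1
    obtain ⟨hW, hW1, hW2, -, hWx, hV1, hV2, -⟩ := weight_norms (ω := ω) hB₁ hB₂ hB₃ hB₄ hΛ hΛΛ' ξ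
    rw [sliceSymbolFnD2Xi1]
    have nI : ∀ z : ℂ, ‖I * z‖ = ‖z‖ := fun z => by rw [norm_mul, Complex.norm_I, one_mul]
    calc _ ≤ ‖(sliceWeightFnD2Xi Λ Λ' ξ ω : ℂ) * resolventFn c θ ξ ω‖ + ‖(sliceWeightFnD2 Λ Λ' ξ ω : ℂ) * (I * resolventFnD1 c θ ξ ω)‖ +
          ‖2 * ((sliceWeightFnD1Xi Λ Λ' ξ ω : ℂ) * resolventFnD1 c θ ξ ω + (sliceWeightFnD1 Λ Λ' ξ ω : ℂ) * (I * resolventFnD2 c θ ξ ω))‖ +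
          (‖(sliceWeightFnD1 Λ Λ' ω ξ : ℂ) * resolventFnD2 c θ ξ ω‖ + ‖(sliceWeightFn Λ Λ' ξ ω : ℂ) * (I * resolventFnD3 c θ ξ ω)‖) :=
          (norm_add_le _ _).trans (add_le_add ((norm_add_le _ _).trans (add_le_add (norm_add_le _ _) le_rfl)) (norm_add_le _ _))
      _ ≤ (16 * B₃ + 8 * B₂) / Λ ^ 3 * (4 * c / Λ) + (8 * B₂ + 4 * B₁) / Λ ^ 2 * (16 * c / Λ ^ 2) +
          2 * (8 * B₂ / Λ ^ 2 * (16 * c / Λ ^ 2) + 4 * B₁ / Λ * (128 * c / Λ ^ 3)) +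
          (4 * B₁ / Λ * (128 * c / Λ ^ 3) + 1 * (1536 * c / Λ ^ 4)) := by
          simp only [norm_mul, nI, Complex.norm_ofNat]
          refine add_le_add (add_le_add (add_le_add (mul_le_mul hV2 hR (norm_nonneg _) (by positivity))
            (mul_le_mul hW2 hR1 (norm_nonneg _) (by positivity))) (mul_le_mul_of_nonneg_left ((norm_add_le _ _).trans ?_) (by norm_num)))
            (add_le_add (mul_le_mul hWx hR2 (norm_nonneg _) (by positivity)) (mul_le_mul hW hR3 (norm_nonneg _) zero_le_one))
          simp only [norm_mul, nI]
          exact add_le_add (mul_le_mul hV1 hR1 (norm_nonneg _) (by positivity)) (mul_le_mul hW1 hR2 (norm_nonneg _) (by positivity))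
      _ = (64 * B₃ + 416 * B₂ + 1600 * B₁ + 1536) * c / Λ ^ 4 := by field_simp; ring

/-- **`‖∂_ξΨ‴‖ ≤ (128B₄ + 1216B₃ + 6912B₂ + 26112B₁ + 24576)·c/Λ⁵`** everywhere. [cite: BenfattoGiulianiMastropietro2006, (2.36aa)] -/
theorem norm_sliceSymbolFnD3Xi1_le (hΛ : 0 < Λ) (hΛΛ' : Λ ≤ Λ') (hθ : |θ| ≤ Λ / 4) (hc : 0 ≤ c)
    (hB₁ : ∀ x, |deriv salmhoferCutoff x| ≤ B₁) (hB₂ : ∀ x, |deriv (deriv salmhoferCutoff) x| ≤ B₂)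
    (hB₃ : ∀ x, |deriv (deriv (deriv salmhoferCutoff)) x| ≤ B₃) (hB₄ : ∀ x, |deriv (deriv (deriv (deriv salmhoferCutoff))) x| ≤ B₄)
    (ξ : ℝ) : ‖sliceSymbolFnD3Xi1 c θ Λ Λ' ξ ω‖ ≤ (128 * B₄ + 1216 * B₃ + 6912 * B₂ + 26112 * B₁ + 24576) * c / Λ ^ 5 := by
  have hB10 : 0 ≤ B₁ := (abs_nonneg _).trans (hB₁ 0)
  have hB20 : 0 ≤ B₂ := (abs_nonneg _).trans (hB₂ 0)
  have hB30 : 0 ≤ B₃ := (abs_nonneg _).trans (hB₃ 0)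
  have hB40 : 0 ≤ B₄ := (abs_nonneg _).trans (hB₄ 0)
  by_cases hmem : ω ^ 2 + ξ ^ 2 < Λ ^ 2 / 4 ∨ Λ' ^ 2 < ω ^ 2 + ξ ^ 2
  · obtain ⟨h0, h1, h2⟩ := sliceWeightFn_eq_zero_of_not_mem hΛ hΛΛ' hmem
    have h3 := sliceWeightFnD3_eq_zero_of_not_mem hΛ hΛΛ' hmem
    have hmem' : ξ ^ 2 + ω ^ 2 < Λ ^ 2 / 4 ∨ Λ' ^ 2 < ξ ^ 2 + ω ^ 2 := by rcases hmem with h | h <;> [left; right] <;> linarith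
    obtain ⟨-, h1', -⟩ := sliceWeightFn_eq_zero_of_not_mem hΛ hΛΛ' hmem'
    obtain ⟨v1, v2, v3⟩ := sliceWeightFnDXi_eq_zero_of_not_mem hΛ hΛΛ' hmem
    rw [sliceSymbolFnD3Xi1, h0, h1, h2, h3, h1', v1, v2, v3, Complex.ofReal_zero]
    simp only [zero_mul, mul_zero, add_zero, norm_zero]
    positivity
  · rw [not_or, not_lt, not_lt] at hmem
    obtain ⟨hR, hR1, hR2, hR3, hR4⟩ := resolvent_norms_on_shell (c := c) hθ hc hΛ hmem.1
    obtain ⟨hW, hW1, hW2, hW3, hWx, hV1, hV2, hV3⟩ := weight_norms (ω := ω) hB₁ hB₂ hB₃ hB₄ hΛ hΛΛ' ξ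
    rw [sliceSymbolFnD3Xi1]
    have nI : ∀ z : ℂ, ‖I * z‖ = ‖z‖ := fun z => by rw [norm_mul, Complex.norm_I, one_mul]
    calc _ ≤ ‖(sliceWeightFnD3Xi Λ Λ' ξ ω : ℂ) * resolventFn c θ ξ ω‖ + ‖(sliceWeightFnD3 Λ Λ' ξ ω : ℂ) * (I * resolventFnD1 c θ ξ ω)‖ +
          ‖3 * ((sliceWeightFnD2Xi Λ Λ' ξ ω : ℂ) * resolventFnD1 c θ ξ ω + (sliceWeightFnD2 Λ Λ' ξ ω : ℂ) * (I * resolventFnD2 c θ ξ ω))‖ +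
          ‖3 * ((sliceWeightFnD1Xi Λ Λ' ξ ω : ℂ) * resolventFnD2 c θ ξ ω + (sliceWeightFnD1 Λ Λ' ξ ω : ℂ) * (I * resolventFnD3 c θ ξ ω))‖ +
          (‖(sliceWeightFnD1 Λ Λ' ω ξ : ℂ) * resolventFnD3 c θ ξ ω‖ + ‖(sliceWeightFn Λ Λ' ξ ω : ℂ) * (I * resolventFnD4 c θ ξ ω)‖) :=
          (norm_add_le _ _).trans (add_le_add ((norm_add_le _ _).trans (add_le_add ((norm_add_le _ _).trans
            (add_le_add (norm_add_le _ _) le_rfl)) le_rfl)) (norm_add_le _ _))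
      _ ≤ (32 * B₄ + 48 * B₃) / Λ ^ 4 * (4 * c / Λ) + (16 * B₃ + 24 * B₂) / Λ ^ 3 * (16 * c / Λ ^ 2) +
          3 * ((16 * B₃ + 8 * B₂) / Λ ^ 3 * (16 * c / Λ ^ 2) + (8 * B₂ + 4 * B₁) / Λ ^ 2 * (128 * c / Λ ^ 3)) +
          3 * (8 * B₂ / Λ ^ 2 * (128 * c / Λ ^ 3) + 4 * B₁ / Λ * (1536 * c / Λ ^ 4)) +
          (4 * B₁ / Λ * (1536 * c / Λ ^ 4) + 1 * (24576 * c / Λ ^ 5)) := by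
          simp only [norm_mul, nI, Complex.norm_ofNat]
          refine add_le_add (add_le_add (add_le_add (add_le_add (mul_le_mul hV3 hR (norm_nonneg _) (by positivity))
            (mul_le_mul hW3 hR1 (norm_nonneg _) (by positivity)))
            (mul_le_mul_of_nonneg_left ((norm_add_le _ _).trans ?_) (by norm_num)))
            (mul_le_mul_of_nonneg_left ((norm_add_le _ _).trans ?_) (by norm_num)))
            (add_le_add (mul_le_mul hWx hR3 (norm_nonneg _) (by positivity)) (mul_le_mul hW hR4 (norm_nonneg _) zero_le_one))
          · simp only [norm_mul, nI]
            exact add_le_add (mul_le_mul hV2 hR1 (norm_nonneg _) (by positivity)) (mul_le_mul hW2 hR2 (norm_nonneg _) (by positivity))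
          · simp only [norm_mul, nI]
            exact add_le_add (mul_le_mul hV1 hR2 (norm_nonneg _) (by positivity)) (mul_le_mul hW1 hR3 (norm_nonneg _) (by positivity))
      _ = (128 * B₄ + 1216 * B₃ + 6912 * B₂ + 26112 * B₁ + 24576) * c / Λ ^ 5 := by field_simp; ring

end Bounds

/-! ### §3 The band increments of `Ψ′, Ψ″, Ψ‴` -/

section Incr

variable {B₁ B₂ B₃ B₄ : ℝ}

/-- **`‖Ψ′(ξ + y, ω) − Ψ′(ξ, ω)‖ ≤ (32B₂+128B₁+128)(c/Λ³)·|y|`.** [cite: BenfattoGiulianiMastropietro2006, §3 (3.2)] -/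
theorem norm_sliceSymbolFnD1_sub_xi_le (hΛ : 0 < Λ) (hΛΛ' : Λ ≤ Λ') (hθ : |θ| ≤ Λ / 4) (hc : 0 ≤ c)
    (hB₁ : ∀ x, |deriv salmhoferCutoff x| ≤ B₁) (hB₂ : ∀ x, |deriv (deriv salmhoferCutoff) x| ≤ B₂)
    (hB₃ : ∀ x, |deriv (deriv (deriv salmhoferCutoff)) x| ≤ B₃) (hB₄ : ∀ x, |deriv (deriv (deriv (deriv salmhoferCutoff))) x| ≤ B₄)
    (ξ y : ℝ) : ‖sliceSymbolFnD1 c θ Λ Λ' (ξ + y) ω - sliceSymbolFnD1 c θ Λ Λ' ξ ω‖ ≤ (32 * B₂ + 128 * B₁ + 128) * c / Λ ^ 3 * |y| :=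
  norm_sub_le_of_hasDerivAt_bound (f := fun t => sliceSymbolFnD1 c θ Λ Λ' t ω) (fun x => hasDerivAt_sliceSymbolFnD1_xi hΛ hΛΛ' hθ x)
    (fun x => norm_sliceSymbolFnD1Xi1_le hΛ hΛΛ' hθ hc hB₁ hB₂ hB₃ hB₄ x) ξ y

/-- **`‖Ψ″(ξ + y, ω) − Ψ″(ξ, ω)‖ ≤ (64B₃+416B₂+1600B₁+1536)(c/Λ⁴)·|y|`.** [cite: BenfattoGiulianiMastropietro2006, §3 (3.2)] -/
theorem norm_sliceSymbolFnD2_sub_xi_le (hΛ : 0 < Λ) (hΛΛ' : Λ ≤ Λ') (hθ : |θ| ≤ Λ / 4) (hc : 0 ≤ c)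
    (hB₁ : ∀ x, |deriv salmhoferCutoff x| ≤ B₁) (hB₂ : ∀ x, |deriv (deriv salmhoferCutoff) x| ≤ B₂)
    (hB₃ : ∀ x, |deriv (deriv (deriv salmhoferCutoff)) x| ≤ B₃) (hB₄ : ∀ x, |deriv (deriv (deriv (deriv salmhoferCutoff))) x| ≤ B₄)
    (ξ y : ℝ) :
    ‖sliceSymbolFnD2 c θ Λ Λ' (ξ + y) ω - sliceSymbolFnD2 c θ Λ Λ' ξ ω‖ ≤ (64 * B₃ + 416 * B₂ + 1600 * B₁ + 1536) * c / Λ ^ 4 * |y| :=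
  norm_sub_le_of_hasDerivAt_bound (f := fun t => sliceSymbolFnD2 c θ Λ Λ' t ω) (fun x => hasDerivAt_sliceSymbolFnD2_xi hΛ hΛΛ' hθ x)
    (fun x => norm_sliceSymbolFnD2Xi1_le hΛ hΛΛ' hθ hc hB₁ hB₂ hB₃ hB₄ x) ξ y

/-- **`‖Ψ‴(ξ + y, ω) − Ψ‴(ξ, ω)‖ ≤ (128B₄+1216B₃+6912B₂+26112B₁+24576)(c/Λ⁵)·|y|`.** [cite: BenfattoGiulianiMastropietro2006, §3 (3.2)] -/
theorem norm_sliceSymbolFnD3_sub_xi_le (hΛ : 0 < Λ) (hΛΛ' : Λ ≤ Λ') (hθ : |θ| ≤ Λ / 4) (hc : 0 ≤ c)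
    (hB₁ : ∀ x, |deriv salmhoferCutoff x| ≤ B₁) (hB₂ : ∀ x, |deriv (deriv salmhoferCutoff) x| ≤ B₂)
    (hB₃ : ∀ x, |deriv (deriv (deriv salmhoferCutoff)) x| ≤ B₃) (hB₄ : ∀ x, |deriv (deriv (deriv (deriv salmhoferCutoff))) x| ≤ B₄)
    (ξ y : ℝ) :
    ‖sliceSymbolFnD3 c θ Λ Λ' (ξ + y) ω - sliceSymbolFnD3 c θ Λ Λ' ξ ω‖ ≤
      (128 * B₄ + 1216 * B₃ + 6912 * B₂ + 26112 * B₁ + 24576) * c / Λ ^ 5 * |y| :=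
  norm_sub_le_of_hasDerivAt_bound (f := fun t => sliceSymbolFnD3 c θ Λ Λ' t ω) (fun x => hasDerivAt_sliceSymbolFnD3_xi hΛ hΛΛ' hθ x)
    (fun x => norm_sliceSymbolFnD3Xi1_le hΛ hΛΛ' hθ hc hB₁ hB₂ hB₃ hB₄ x) ξ y

end Incr

/-! ### §4 Third time differences of a band increment -/

/-- **Third frequency differences of the band increment `ω ↦ Ψ(ξ+y, ω) − Ψ(ξ, ω)`**: `≤ δ³·(128B₄+1216B₃+6912B₂+26112B₁+24576)(c/Λ⁵)·|y|`
(`δ ≥ 0`): the increment of the slice symbol across a frame piece of size `|y|` is small in the time direction too.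
[cite: BenfattoGiulianiMastropietro2006, §3 (3.2)–(3.8)] -/
theorem norm_fwdDiff_iter_three_sliceSymbolFn_incr_le {c θ Λ Λ' ξ y : ℝ} (hΛ : 0 < Λ) (hΛΛ' : Λ ≤ Λ') (hθ : |θ| ≤ Λ / 4) (hc : 0 ≤ c)
    {B₁ B₂ B₃ B₄ : ℝ} (hB₁ : ∀ x, |deriv salmhoferCutoff x| ≤ B₁) (hB₂ : ∀ x, |deriv (deriv salmhoferCutoff) x| ≤ B₂)
    (hB₃ : ∀ x, |deriv (deriv (deriv salmhoferCutoff)) x| ≤ B₃) (hB₄ : ∀ x, |deriv (deriv (deriv (deriv salmhoferCutoff))) x| ≤ B₄)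
    {δ : ℝ} (hδ : 0 ≤ δ) (ω : ℝ) :
    ‖(fwdDiff δ)^[3] (fun t => sliceSymbolFn c θ Λ Λ' (ξ + y) t - sliceSymbolFn c θ Λ Λ' ξ t) ω‖ ≤
      δ ^ 3 * ((128 * B₄ + 1216 * B₃ + 6912 * B₂ + 26112 * B₁ + 24576) * c / Λ ^ 5 * |y|) := by
  set G : ℕ → ℝ → ℂ := fun k t =>
      if k = 0 then sliceSymbolFn c θ Λ Λ' (ξ + y) t - sliceSymbolFn c θ Λ Λ' ξ t
      else if k = 1 then sliceSymbolFnD1 c θ Λ Λ' (ξ + y) t - sliceSymbolFnD1 c θ Λ Λ' ξ t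
      else if k = 2 then sliceSymbolFnD2 c θ Λ Λ' (ξ + y) t - sliceSymbolFnD2 c θ Λ Λ' ξ t
      else if k = 3 then sliceSymbolFnD3 c θ Λ Λ' (ξ + y) t - sliceSymbolFnD3 c θ Λ Λ' ξ t
      else 0 with hG
  have hchain : ∀ k < 3, ∀ t, HasDerivAt (G k) (G (k + 1) t) t := by
    intro k hk t
    interval_cases k
    · show HasDerivAt (fun t => sliceSymbolFn c θ Λ Λ' (ξ + y) t - sliceSymbolFn c θ Λ Λ' ξ t)
        (sliceSymbolFnD1 c θ Λ Λ' (ξ + y) t - sliceSymbolFnD1 c θ Λ Λ' ξ t) t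
      exact (hasDerivAt_sliceSymbolFn hΛ hΛΛ' hθ t).sub (hasDerivAt_sliceSymbolFn hΛ hΛΛ' hθ t)
    · show HasDerivAt (fun t => sliceSymbolFnD1 c θ Λ Λ' (ξ + y) t - sliceSymbolFnD1 c θ Λ Λ' ξ t)
        (sliceSymbolFnD2 c θ Λ Λ' (ξ + y) t - sliceSymbolFnD2 c θ Λ Λ' ξ t) t
      exact (hasDerivAt_sliceSymbolFnD1 hΛ hΛΛ' hθ t).sub (hasDerivAt_sliceSymbolFnD1 hΛ hΛΛ' hθ t)
    · show HasDerivAt (fun t => sliceSymbolFnD2 c θ Λ Λ' (ξ + y) t - sliceSymbolFnD2 c θ Λ Λ' ξ t)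
        (sliceSymbolFnD3 c θ Λ Λ' (ξ + y) t - sliceSymbolFnD3 c θ Λ Λ' ξ t) t
      exact (hasDerivAt_sliceSymbolFnD2 hΛ hΛΛ' hθ t).sub (hasDerivAt_sliceSymbolFnD2 hΛ hΛΛ' hθ t)
  have h := Literature.Analysis.norm_fwdDiff_iter_le_of_hasDerivAt hδ 3 G ω
    ((128 * B₄ + 1216 * B₃ + 6912 * B₂ + 26112 * B₁ + 24576) * c / Λ ^ 5 * |y|)
    (fun k hk s _ => hchain k hk s) (fun s _ => by
      show ‖G 3 s‖ ≤ _
      have : G 3 s = sliceSymbolFnD3 c θ Λ Λ' (ξ + y) s - sliceSymbolFnD3 c θ Λ Λ' ξ s := by simp [hG]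
      rw [this]; exact norm_sliceSymbolFnD3_sub_xi_le hΛ hΛΛ' hθ hc hB₁ hB₂ hB₃ hB₄ ξ y)
  have h0 : G 0 = fun t => sliceSymbolFn c θ Λ Λ' (ξ + y) t - sliceSymbolFn c θ Λ Λ' ξ t := by funext s; simp [hG]
  rw [h0] at h
  exact h

end Symbol

end Literature.MathematicalPhysics.QuantumLattice

end
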